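import Literature.AnabelianGeometry.EtaleTheta.KummerMapExactness
import Literature.AnabelianGeometry.AbsoluteAnabelian.AbsTopIII.KummerFaithfulPadicProofs
import Summits.ABC.IUTFork.LanaKummerTower
import HarnessLib

/-!
# L-LANA objects XII quinquies: `κ : K̄_v^× → lim_{→ H} H¹(H, Λ)` is INJECTIVE (LANA §6.1 / §4.2 (b); N13) — PROVED at `ℚ_p`, and for every torally Kummer-faithful `K_v`

Proof-only companion (theorems, no definitions) of `LanaKummerTower.lean` (seat abc-iut-c312-4, L-LANA level,
plan/LLANA-SPEC N13/N14 Step 6); TAKES NO SIDE on [IUTchIII] Cor. 3.12. LANA §6.2 (g) p. 35 uses the local Kummer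
maps "`κ_t : O^▷_{v,t} → ∞H¹(D_t, Λ_{v,t})`" through their images only, and `LanaEtaAlgorithm.lean` shows that the
bookkeeping "`φ_v` injective", "Containment ⟺ Factors, uniquely" needs exactly the INJECTIVITY of the `κ_t`
(hypothesis `hκ`). For the CONSTRUCTED tower `AlgCl.kummerTower K_v : K̄_v^× → lim_{→ H ⊴ G_v open} H¹(H, Λ(K̄_v^×))`:

* `AlgCl.kummerTower_injective_of` — `κ` is injective on ALL of `K̄_v^×` as soon as `K_v` is torally
  Kummer-faithful ([AbsTopIII] Def. 1.5: `⋂_n (E^×)^n = 1` for every finite extension `E/K_v` — seat abc-iut-L4's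
  presentation-free `IsTorallyKummerFaithful`). Proof: by the kernel criterion of the colimit
  (`kummerMapHom_injective_of`, `EtaleTheta/KummerMapExactness.lean`: exactness of the direct limit + the
  level-wise kernel `kummerClass_eq_zero_iff`), a class `κ(a) = 0` gives `n`-th roots of `a` fixed by an open
  level `H`, i.e. lying in the fixed field `E = K̄_v^H`, a FINITE extension of `K_v` (Mathlib infinite Galois
  theory: `fixingSubgroup_fixedField`, `isOpen_iff_finite`), where `⋂_n (E^×)^n = 1` forces `a = 1`;
* `AlgCl.kummerTowerInt_injective_of` — hence `κ` on `O^▷_{K̄_v}` (§6.2 (g)) is injective;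
* `AlgCl.padic_kummerTower_injective`, `padic_kummerTowerInt_injective` — **UNCONDITIONAL at `K_v = ℚ_p`**
  (`ℚ_p` is torally Kummer-faithful: seat abc-iut-L4's `isTorallyKummerFaithful_padic`,
  `AbsTopIII/KummerFaithfulPadicProofs.lean`).

[cite: LANA2026Report, §6.1 pp. 31–32, §6.2 (g) p. 35, §4.2 (b) p. 26] [cite: MochizukiAbsTopIII2015, Def 1.5 p. 32]
NOT here: finite places of number fields (the normed structure on `K_v` is a local instance there — companion of
`LanaKummerInjectiveAdic.lean`); any judgement.
-/

noncomputable section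

namespace Summit.ABC
namespace IUTFork
namespace AlgCl

open Literature.AnabelianGeometry.EtaleTheta
open Literature.AnabelianGeometry.AbsoluteAnabelian.AbsTopIII (DivisibleElementsTrivial IsTorallyKummerFaithful)

section General

variable (K₀ : Type) [NontriviallyNormedField K₀]

/-- A unit of `K̄_v` invariant under a level `H` lies in the fixed field `K̄_v^H`. [folklore] -/
theorem coe_mem_fixedField_of_mem_invariants (i : Level K₀) {a : (AlgCl K₀)ˣ}
    (ha : a ∈ invariants (A := (AlgCl K₀)ˣ) (levelSubgroup K₀ i)) :
    (a : AlgCl K₀) ∈ IntermediateField.fixedField (levelSubgroup K₀ i) := by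
  rw [IntermediateField.mem_fixedField_iff]
  intro σ hσ
  have h : σ • a = a := ha ⟨σ, hσ⟩
  have h' : ((σ • a : (AlgCl K₀)ˣ) : AlgCl K₀) = a := congrArg (fun u : (AlgCl K₀)ˣ => (u : AlgCl K₀)) h
  rwa [units_coe_smul] at h'

/-- A unit of `K̄_v` invariant under a level, as a unit of the fixed field `K̄_v^H`. [folklore] -/
def unitOfInvariant (i : Level K₀) (a : (AlgCl K₀)ˣ)
    (ha : a ∈ invariants (A := (AlgCl K₀)ˣ) (levelSubgroup K₀ i)) :
    (IntermediateField.fixedField (levelSubgroup K₀ i))ˣ where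
  val := ⟨a, coe_mem_fixedField_of_mem_invariants K₀ i ha⟩
  inv := ⟨(a⁻¹ : (AlgCl K₀)ˣ), coe_mem_fixedField_of_mem_invariants K₀ i (inv_mem ha)⟩
  val_inv := Subtype.ext (by simp)
  inv_val := Subtype.ext (by simp)

/-- Underlying element of `unitOfInvariant`. [folklore] -/
@[simp] theorem coe_coe_unitOfInvariant (i : Level K₀) (a : (AlgCl K₀)ˣ)
    (ha : a ∈ invariants (A := (AlgCl K₀)ˣ) (levelSubgroup K₀ i)) :
    (((unitOfInvariant K₀ i a ha : (IntermediateField.fixedField (levelSubgroup K₀ i))ˣ) :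
      IntermediateField.fixedField (levelSubgroup K₀ i)) : AlgCl K₀) = a := rfl

/-- `unitOfInvariant` is multiplicative in the evident sense: powers. [folklore] -/
theorem unitOfInvariant_pow (i : Level K₀) (b : (AlgCl K₀)ˣ)
    (hb : b ∈ invariants (A := (AlgCl K₀)ˣ) (levelSubgroup K₀ i)) (n : ℕ) :
    unitOfInvariant K₀ i b hb ^ n =
      unitOfInvariant K₀ i (b ^ n) ((invariants (A := (AlgCl K₀)ˣ) (levelSubgroup K₀ i)).pow_mem hb n) := by
  apply Units.ext
  apply Subtype.ext
  rw [Units.val_pow_eq_pow_val]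
  change (((unitOfInvariant K₀ i b hb : (IntermediateField.fixedField (levelSubgroup K₀ i))ˣ) :
      IntermediateField.fixedField (levelSubgroup K₀ i)) : AlgCl K₀) ^ n = ((b ^ n : (AlgCl K₀)ˣ) : AlgCl K₀)
  rw [coe_coe_unitOfInvariant, Units.val_pow_eq_pow_val]

variable [CharZero K₀]

/-- The fixed field `K̄_v^H` of a level `H` (open, normal) is a FINITE extension of `K_v` (fundamental theorem
of infinite Galois theory: `H` is closed, so `Gal(K̄_v/K̄_v^H) = H`, and open fixing subgroups correspond to
finite subextensions). [folklore] -/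
theorem finiteDimensional_fixedField (i : Level K₀) :
    FiniteDimensional K₀ (IntermediateField.fixedField (levelSubgroup K₀ i)) := by
  let U : ClosedSubgroup (Gal K₀) := ⟨levelSubgroup K₀ i, i.1.isClosed⟩
  have key : (IntermediateField.fixedField (levelSubgroup K₀ i)).fixingSubgroup = levelSubgroup K₀ i :=
    InfiniteGalois.fixingSubgroup_fixedField U
  refine (InfiniteGalois.isOpen_iff_finite _).mp ?_
  change IsOpen ((IntermediateField.fixedField (levelSubgroup K₀ i)).fixingSubgroup : Set (Gal K₀))
  rw [key]
  exact i.1.isOpen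

/-- **INJECTIVITY of `κ : K̄_v^× → lim_{→ H} H¹(H, Λ(K̄_v^×))`** for a torally Kummer-faithful `K_v`
([AbsTopIII] Def. 1.5: `⋂_n (E^×)^n = 1` for all finite `E/K_v`): see the module docstring for the proof.
[cite: LANA2026Report, §6.1 pp. 31–32] [cite: MochizukiAbsTopIII2015, Def 1.5 p. 32] -/
theorem kummerTower_injective_of (hK : IsTorallyKummerFaithful K₀) : Function.Injective (kummerTower K₀) := by
  refine kummerMapHom_injective_of (levelSubgroup K₀) (levelSubgroup_anti K₀) (isExhausted_units K₀) ?_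
  intro i a ha hroots
  haveI : FiniteDimensional K₀ (IntermediateField.fixedField (levelSubgroup K₀ i)) :=
    finiteDimensional_fixedField K₀ i
  have hDT : DivisibleElementsTrivial (IntermediateField.fixedField (levelSubgroup K₀ i))ˣ :=
    hK.units _ inferInstance
  have haE1 : unitOfInvariant K₀ i a ha = 1 :=
    hDT.eq_one_of_forall_exists_pow _ fun n hn => by
      obtain ⟨b, hb, hbn⟩ := hroots ⟨n, hn⟩
      refine ⟨unitOfInvariant K₀ i b hb, ?_⟩
      rw [unitOfInvariant_pow]
      have hbn' : b ^ n = a := hbn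
      exact Units.ext (Subtype.ext (by rw [coe_coe_unitOfInvariant, coe_coe_unitOfInvariant, hbn']))
  have h1 : (a : AlgCl K₀) = 1 := by
    have := congrArg (fun u : (IntermediateField.fixedField (levelSubgroup K₀ i))ˣ =>
      (((u : (IntermediateField.fixedField (levelSubgroup K₀ i))) : AlgCl K₀))) haE1
    simpa using this
  exact Units.ext h1

/-- Consequently `κ(a) = 0 ⟺ a = 1` for every `a ∈ K̄_v^×` (torally Kummer-faithful `K_v`).
[cite: LANA2026Report, §6.1 p. 31] -/
theorem kummerTower_eq_zero_iff_of (hK : IsTorallyKummerFaithful K₀) (a : (AlgCl K₀)ˣ) :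
    kummerTower K₀ (Additive.ofMul a) = 0 ↔ a = 1 := by
  constructor
  · intro h0
    exact Additive.ofMul.injective (kummerTower_injective_of K₀ hK (by rw [h0, ofMul_one, map_zero]))
  · rintro rfl
    exact map_zero (kummerTower K₀)

variable [CompleteSpace K₀] [IsUltrametricDist K₀]

/-- **The local Kummer map on `O^▷_{K̄_v}` (§6.2 (g) "`κ_t : O^▷_{v,t} → ∞H¹(D_t, Λ_{v,t})`") is INJECTIVE** for a
torally Kummer-faithful `K_v` — the hypothesis `hκ` of `LanaEtaAlgorithm`'s `phiProd_injective` /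
`containment_iff_factors` for the real `κ_t`. [cite: LANA2026Report, §6.2 (g) p. 35] -/
theorem kummerTowerInt_injective_of (hK : IsTorallyKummerFaithful K₀) :
    Function.Injective (kummerTowerInt K₀) := fun a b h => by
  apply intMonoidToUnits_injective K₀
  have h' := congrArg Multiplicative.toAdd h
  rw [toAdd_kummerTowerInt, toAdd_kummerTowerInt] at h'
  exact Additive.ofMul.injective (kummerTower_injective_of K₀ hK h')

end General

/-! ### `K_v = ℚ_p`: no hypothesis left -/

section Padic

variable (p : ℕ) [Fact p.Prime]

/-- **At `ℚ_p`, UNCONDITIONALLY: `κ : ℚ̄_p^× → lim_{→ H} H¹(H, Λ(ℚ̄_p^×))` is injective.**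
[cite: LANA2026Report, §6.1 pp. 31–32] -/
theorem padic_kummerTower_injective : Function.Injective (kummerTower ℚ_[p]) :=
  kummerTower_injective_of ℚ_[p]
    (Literature.AnabelianGeometry.AbsoluteAnabelian.AbsTopIII.isTorallyKummerFaithful_padic p)

/-- … and so is the local Kummer map on `O^▷_{ℚ̄_p}` (§6.2 (g)). [cite: LANA2026Report, §6.2 (g) p. 35] -/
theorem padic_kummerTowerInt_injective : Function.Injective (kummerTowerInt ℚ_[p]) :=
  kummerTowerInt_injective_of ℚ_[p]
    (Literature.AnabelianGeometry.AbsoluteAnabelian.AbsTopIII.isTorallyKummerFaithful_padic p)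

end Padic

end AlgCl

end IUTFork

end Summit.ABC

end
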